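import Literature.NumberTheory.LFunctions.MontgomeryDirichletSumMeanSquareProofs
import Literature.NumberTheory.LFunctions.DirichletPolynomialSelbergMVT
import HarnessLib

/-!
# The mean square of Montgomery's Dirichlet series, sharp form (Goldston–Montgomery 1987, Lemma 7)

Topic `Literature/NumberTheory/LFunctions` (namespace `Literature.NumberTheory.LFunctions`, proof objects in
`Montgomery`). Proofs only: no definitions, no named facts. Companion of
`MontgomeryDirichletSumMeanSquareProofs.lean`, where the named fact (P3)
`montgomery_dirichletSum_meanSquare` of `MontgomeryPairCorrelation.lean` is discharged in the printed form
`∫_0^T |A(x,t)|² dt = T x log x + O(Tx) + O(x²(log x + 1))`, `A(x,t) = ∑_n Λ(n) a_n(x) n^{-it}`,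
`a_n(x) = min((n/x)^{1/2}, (x/n)^{3/2})` (Goldston 2005, (4.6), via the Montgomery–Vaughan mean value
theorem). Here we prove the SHARPER remainder that Goldston–Montgomery obtain "by using a sieve bound for
prime twins" (Goldston 2005, remark after Theorem 1: "The error term `O(x log x)` in (4.7) can be improved to
`O(x)` … [GoMo], which shows the theorem holds for `0 ≤ α ≤ 1`"; Goldston–Montgomery 1987, §3, Lemma 7:
"`∫_0^T |∑_p c(p) p^{it}|² dt = (T + O(δ⁻¹)) ∑_p |c(p)|² + O(δT ∫ C(u)² u (log u)⁻² du)` … proof: we appeal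
to the previous lemma [Lemma 6] … `π₂(x, k) ≪ (k/φ(k)) x (log x)⁻²` uniformly … `∑_{k ≤ K} k/φ(k) ≪ K`"):

* `Montgomery.exists_nearDiag_montgomeryCoeff_le` — the near-diagonal prime-pair sum: there is an
  absolute `C` with `∑_{1 ≤ m ≠ n ≤ N, |log n − log m| < η} a_m a_n ≤ C η x²` for all `x ≥ 1`,
  `0 < η ≤ 1/2` and all `N` (`a_n = Λ(n) a_n(x)`): the pairs are `n = m + h` with `h < 2ηm`; for `m ≤ x`
  the prime-pair sieve bound `∑_{h < m ≤ M} Λ(m)Λ(m+h) ≤ C (h/φ(h)) M`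
  (`Montgomery.exists_sum_Ioc_vonMangoldt_mul_shift_le`) and `∑_{h ≤ H} h/φ(h) ≤ eH`
  (`Sieve.Lichtman2020.sum_div_totient_le`) over `h < 2ηx` give `≪ ηx²`; for `m > x` the weight
  `x³/m³` and the tails `∑_{m > Y} Λ(m)Λ(m+h)/m² ≤ 4C (h/φ(h))/Y`
  (`Montgomery.sum_Ioc_div_sq_le_of_chebyshev`) with `Y = max(⌊x⌋, ⌊h/(2η)⌋)` give `≪ ηx²` again
  (the coupling `h < 2ηm` is kept throughout — summing `h` up to `x` would cost the factor `log x` of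
  the Montgomery–Vaughan form);
* `Montgomery.exists_meanSquare_dirichletSum_sharp` — **(P3♯)**: there is an absolute `C` such that for
  all `x ≥ 1` and `T ≥ 4`,
  `|∫_0^T |A(x,t)|² dt − T x log x| ≤ C (T x + x² + x^{3/2} √(T (log x + 1)))`,
  from Goldston–Montgomery's Lemma 6 (`SelbergMVT.abs_meanSquare_tsum_sub_le_nearDiag`,
  `DirichletPolynomialSelbergMVT.lean`) with `2πΔ = η = √((log x + 1)/(T x))`, the near-diagonal bound,
  and the diagonal `∑ a_n² = x log x + O(x)` (`MontgomeryCoefficientSums.lean`). For `x ≤ T` the middle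
  term is dominated by the last; at `x = T^α`, after division by `x T log T`, the remainder is
  `O(1/log T + T^{(α−1)/2} √(α + 1/log T)/√(log T))`, i.e. `O(1/√log T)` uniformly for `0 ≤ α ≤ 1` — the
  input of Montgomery's theorem with the Goldston–Montgomery error term
  (`MontgomeryTheoremGoldstonMontgomery.lean`).

## References

* [GoldstonMontgomery1987] D. A. Goldston, H. L. Montgomery, *Pair correlation of zeros and primes in short
  intervals*, Progr. Math. 70 (1987), 183–203, §3, Lemmas 6–8.
* [Goldston2005] D. A. Goldston, *Notes on pair correlation of zeros and prime numbers*, LMS Lecture Note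
  Ser. 322 (2005), §4, (4.6)–(4.7) and the remark after Theorem 1.
-/

noncomputable section

open Finset Real MeasureTheory Complex Filter
open ArithmeticFunction hiding log id
open scoped Topology

namespace Literature.NumberTheory.LFunctions

namespace Montgomery

/-! ## Combinatorial preliminaries -/

/-- Symmetrisation of a double sum over ordered pairs `m ≠ n` with a symmetric summand and a symmetric
side condition: it is twice the sum over `m < n`. [folklore] -/
private theorem sum_sum_erase_filter_eq_two_mul (s : Finset ℕ) (g : ℕ → ℕ → ℝ)
    (hg : ∀ m n, g m n = g n m) (P : ℕ → ℕ → Prop) [∀ m n, Decidable (P m n)]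
    (hP : ∀ m n, P m n → P n m) :
    ∑ m ∈ s, ∑ n ∈ (s.erase m).filter (fun n ↦ P m n), g m n =
      2 * ∑ m ∈ s, ∑ n ∈ s.filter (fun n ↦ m < n ∧ P m n), g m n := by
  classical
  have hsplit : ∀ m ∈ s, ∑ n ∈ (s.erase m).filter (fun n ↦ P m n), g m n =
      ∑ n ∈ s.filter (fun n ↦ m < n ∧ P m n), g m n + ∑ n ∈ s.filter (fun n ↦ n < m ∧ P m n), g m n := by
    intro m _
    rw [← Finset.sum_union]
    · congr 1
      ext n
      simp only [Finset.mem_filter, Finset.mem_erase, Finset.mem_union]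
      constructor
      · rintro ⟨⟨hne, hn⟩, hp⟩
        rcases lt_or_gt_of_ne hne with h | h
        · exact Or.inr ⟨hn, h, hp⟩
        · exact Or.inl ⟨hn, h, hp⟩
      · rintro (⟨hn, h, hp⟩ | ⟨hn, h, hp⟩)
        · exact ⟨⟨h.ne', hn⟩, hp⟩
        · exact ⟨⟨h.ne, hn⟩, hp⟩
    · rw [Finset.disjoint_filter]
      intro n _ h1 h2
      exact lt_asymm h1.1 h2.1
  rw [Finset.sum_congr rfl hsplit, Finset.sum_add_distrib, two_mul]
  congr 1
  -- swap the roles of `m` and `n` in the second sum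
  rw [Finset.sum_sigma' s (fun m ↦ s.filter (fun n ↦ n < m ∧ P m n)) (fun m n ↦ g m n),
    Finset.sum_sigma' s (fun m ↦ s.filter (fun n ↦ m < n ∧ P m n)) (fun m n ↦ g m n)]
  refine Finset.sum_bij' (fun p _ ↦ ⟨p.2, p.1⟩) (fun p _ ↦ ⟨p.2, p.1⟩) ?_ ?_ ?_ ?_ ?_
  · rintro ⟨m, n⟩ hp
    simp only [Finset.mem_sigma, Finset.mem_filter] at hp ⊢
    exact ⟨hp.2.1, hp.1, hp.2.2.1, hP _ _ hp.2.2.2⟩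
  · rintro ⟨m, n⟩ hp
    simp only [Finset.mem_sigma, Finset.mem_filter] at hp ⊢
    exact ⟨hp.2.1, hp.1, hp.2.2.1, hP _ _ hp.2.2.2⟩
  · rintro ⟨m, n⟩ _; rfl
  · rintro ⟨m, n⟩ _; rfl
  · rintro ⟨m, n⟩ _; exact hg _ _

/-- Reindexing `n = m + h`: for nonnegative `g` and `m ∈ [1, N]`,
`∑_{n ≤ N, m < n, Q(n)} g(n) ≤ ∑_{1 ≤ h ≤ N, Q(m+h)} g(m+h)`. [folklore] -/
private theorem sum_filter_lt_le_sum_shift (N m : ℕ) (Q : ℕ → Prop) [DecidablePred Q] (g : ℕ → ℝ)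
    (hg : ∀ n, 0 ≤ g n) :
    ∑ n ∈ (Finset.Icc 1 N).filter (fun n ↦ m < n ∧ Q n), g n ≤
      ∑ h ∈ (Finset.Icc 1 N).filter (fun h ↦ Q (m + h)), g (m + h) := by
  classical
  have hinj : Set.InjOn (fun h ↦ m + h) ↑((Finset.Icc 1 N).filter (fun h ↦ Q (m + h))) :=
    fun a _ b _ hab ↦ by simpa using hab
  rw [← Finset.sum_image (f := g) hinj]
  refine Finset.sum_le_sum_of_subset_of_nonneg (fun n hn ↦ ?_) (fun n _ _ ↦ hg n)
  simp only [Finset.mem_filter, Finset.mem_Icc, Finset.mem_image] at hn ⊢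
  obtain ⟨⟨hn1, hnN⟩, hmn, hq⟩ := hn
  refine ⟨n - m, ⟨⟨by omega, by omega⟩, ?_⟩, by omega⟩
  rwa [show m + (n - m) = n by omega]

/-- The side condition `|log(m+h) − log m| < η` with `η ≤ 1/2` forces `h < 2ηm`
(`log(1 + u) ≥ u/(1+u)`). [folklore] -/
private theorem cast_lt_of_abs_log_lt {m h : ℕ} (hm : 1 ≤ m) {η : ℝ} (hη1 : η ≤ 1 / 2)
    (hlog : |Real.log ((m + h : ℕ) : ℝ) - Real.log m| < η) : (h : ℝ) < 2 * η * m := by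
  have hm0 : (0 : ℝ) < m := by exact_mod_cast hm
  have hh0 : (0 : ℝ) ≤ h := by positivity
  have hmh : (0 : ℝ) < m + h := by linarith
  have h1 : (h : ℝ) / (m + h) ≤ Real.log ((m + h) / m) := by
    have hl := Real.log_le_sub_one_of_pos (show (0 : ℝ) < m / (m + h) by positivity)
    rw [Real.log_div hm0.ne' hmh.ne'] at hl
    rw [Real.log_div hmh.ne' hm0.ne']
    have e : (m : ℝ) / (m + h) - 1 = -((h : ℝ) / (m + h)) := by field_simp; ring
    linarith
  have h2 : Real.log (((m : ℝ) + h) / m) < η := by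
    rw [Real.log_div hmh.ne' hm0.ne']
    have := (abs_lt.1 hlog).2
    push_cast at this
    linarith
  have h3 : (h : ℝ) / (m + h) < η := lt_of_le_of_lt h1 h2
  rw [div_lt_iff₀ hmh] at h3
  nlinarith [mul_le_mul_of_nonneg_right hη1 hh0]

/-- The near-diagonal products, divided by `m`: for `1 ≤ m` and `h ≤ m`,
`a_m a_{m+h} ≤ 2 Λ(m)Λ(m+h) min(m²/x, x³/m²)/m`. [folklore] -/
private theorem montgomeryCoeff_mul_shift_le {x : ℝ} (hx : 0 < x) {m h : ℕ} (hm : 1 ≤ m) (hhm : h ≤ m) :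
    montgomeryCoeff x m * montgomeryCoeff x (m + h) ≤
      2 * Λ m * Λ (m + h) * min ((m : ℝ) ^ 2 / x) (x ^ 3 / (m : ℝ) ^ 2) / m := by
  have hm0 : (0 : ℝ) < m := by exact_mod_cast hm
  rw [le_div_iff₀ hm0, mul_comm]
  exact mul_montgomeryCoeff_mul_shift_le hx hm hhm

/-- `min(m²/x, x³/m²)/m ≤ 1` for `m ≤ x` (use `m²/x`). [folklore] -/
private theorem min_div_le_one {x : ℝ} {m : ℕ} (hm : 1 ≤ m) (hmx : (m : ℝ) ≤ x) :
    min ((m : ℝ) ^ 2 / x) (x ^ 3 / (m : ℝ) ^ 2) / m ≤ 1 := by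
  have hm0 : (0 : ℝ) < m := by exact_mod_cast hm
  have hx0 : 0 < x := lt_of_lt_of_le hm0 hmx
  rw [div_le_one hm0]
  refine (min_le_left _ _).trans ?_
  rw [div_le_iff₀ hx0, sq]
  exact mul_le_mul_of_nonneg_left hmx hm0.le

/-- `min(m²/x, x³/m²)/m ≤ x³/m³` (use `x³/m²`). [folklore] -/
private theorem min_div_le_cube {x : ℝ} {m : ℕ} (hm : 1 ≤ m) :
    min ((m : ℝ) ^ 2 / x) (x ^ 3 / (m : ℝ) ^ 2) / m ≤ x ^ 3 / (m : ℝ) ^ 3 := by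
  have hm0 : (0 : ℝ) < m := by exact_mod_cast hm
  rw [div_le_iff₀ hm0]
  refine (min_le_right _ _).trans (le_of_eq ?_)
  field_simp

/-! ## The near-diagonal prime-pair sum: the two ranges -/

/-- `∑_{h ≤ H} h/φ(h) ≤ 3H`. [folklore] -/
private theorem sum_Icc_div_totient_le_three (M : ℕ) :
    ∑ h ∈ Finset.Icc 1 M, (h : ℝ) / Nat.totient h ≤ 3 * M := by
  have hexp3 : Real.exp 1 ≤ 3 := le_of_lt (lt_trans Real.exp_one_lt_d9 (by norm_num))
  exact (Literature.NumberTheory.Sieve.Lichtman2020.sum_div_totient_le M).trans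
    (mul_le_mul_of_nonneg_right hexp3 (by positivity))

/-- Range `m ≤ X` (`X = ⌊x⌋`): for fixed `h`, the `m ≤ X` with `h < 2ηm` lie in `(h, X]`, so the prime-pair
bound gives `≤ 2C (h/φ(h)) X`, and there are no such `m` unless `h ≤ 2ηX`. [folklore] -/
private theorem region_small_le {C : ℝ} (hC : ∀ h : ℕ, 1 ≤ h → ∀ M : ℕ,
      ∑ m ∈ Finset.Ioc h M, Λ m * Λ (m + h) ≤ C * ((h : ℝ) / Nat.totient h) * M)
    {η : ℝ} (hη1 : η ≤ 1 / 2) (X N : ℕ) {h : ℕ} (hh1 : 1 ≤ h) :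
    ∑ m ∈ (Finset.Icc 1 N).filter (fun m : ℕ ↦ (h : ℝ) < 2 * η * m),
        (if m ≤ X then 2 * (Λ m * Λ (m + h)) else 0) ≤
      if (h : ℝ) ≤ 2 * η * X then 2 * C * X * ((h : ℝ) / Nat.totient h) else 0 := by
  classical
  have hΛΛ0 : ∀ m : ℕ, 0 ≤ Λ m * Λ (m + h) := fun m ↦ mul_nonneg vonMangoldt_nonneg vonMangoldt_nonneg
  rw [← Finset.sum_filter]
  by_cases hhX : (h : ℝ) ≤ 2 * η * X
  · rw [if_pos hhX]
    have hsub : ((Finset.Icc 1 N).filter (fun m : ℕ ↦ (h : ℝ) < 2 * η * m)).filter (fun m ↦ m ≤ X) ⊆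
        Finset.Ioc h X := by
      intro m hm
      simp only [Finset.mem_filter, Finset.mem_Icc] at hm
      rw [Finset.mem_Ioc]
      refine ⟨?_, hm.2⟩
      have hm0 : (0 : ℝ) ≤ m := by positivity
      have : (h : ℝ) < m := by nlinarith [hm.1.2, mul_le_mul_of_nonneg_right hη1 hm0]
      exact_mod_cast this
    calc ∑ m ∈ ((Finset.Icc 1 N).filter (fun m : ℕ ↦ (h : ℝ) < 2 * η * m)).filter (fun m ↦ m ≤ X),
          2 * (Λ m * Λ (m + h))
        ≤ ∑ m ∈ Finset.Ioc h X, 2 * (Λ m * Λ (m + h)) :=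
          Finset.sum_le_sum_of_subset_of_nonneg hsub fun m _ _ ↦ by linarith [hΛΛ0 m]
      _ = 2 * ∑ m ∈ Finset.Ioc h X, Λ m * Λ (m + h) := by rw [Finset.mul_sum]
      _ ≤ 2 * (C * ((h : ℝ) / Nat.totient h) * X) := by linarith [hC h hh1 X]
      _ = 2 * C * X * ((h : ℝ) / Nat.totient h) := by ring
  · rw [if_neg hhX]
    refine (Finset.sum_eq_zero fun m hm ↦ ?_).le
    simp only [Finset.mem_filter] at hm
    exfalso
    have h2η : 0 ≤ 2 * η := by
      -- `h < 2ηm` with `h ≥ 1`, `m ≥ 0` forces `2η > 0`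
      by_contra hneg
      push Not at hneg
      have hm0 : (0 : ℝ) ≤ m := by positivity
      have : 2 * η * (m : ℝ) ≤ 0 := mul_nonpos_of_nonpos_of_nonneg hneg.le hm0
      have hh0 : (0 : ℝ) < h := by exact_mod_cast hh1
      linarith [hm.1.2]
    have : (2 * η * m : ℝ) ≤ 2 * η * X := by
      have : (m : ℝ) ≤ X := by exact_mod_cast hm.2
      exact mul_le_mul_of_nonneg_left this h2η
    linarith [hm.1.2]

/-- Range `m ≤ X`, summed over `h`: `≤ 12 C η X²`. [folklore] -/
private theorem sum_region_small_le {C : ℝ} (hC0 : 0 ≤ C) {η : ℝ} (hη : 0 < η) (X N : ℕ) :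
    ∑ h ∈ Finset.Icc 1 N, (if (h : ℝ) ≤ 2 * η * X then 2 * C * X * ((h : ℝ) / Nat.totient h) else 0) ≤
      12 * C * (η * (X : ℝ) ^ 2) := by
  classical
  rw [← Finset.sum_filter]
  have hsub : (Finset.Icc 1 N).filter (fun h : ℕ ↦ (h : ℝ) ≤ 2 * η * X) ⊆ Finset.Icc 1 ⌊2 * η * X⌋₊ := by
    intro h hh
    simp only [Finset.mem_filter, Finset.mem_Icc] at hh ⊢
    exact ⟨hh.1.1, Nat.le_floor hh.2⟩
  have hfl : (⌊2 * η * X⌋₊ : ℝ) ≤ 2 * η * X := Nat.floor_le (by positivity)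
  calc ∑ h ∈ (Finset.Icc 1 N).filter (fun h : ℕ ↦ (h : ℝ) ≤ 2 * η * X), 2 * C * X * ((h : ℝ) / Nat.totient h)
      ≤ ∑ h ∈ Finset.Icc 1 ⌊2 * η * X⌋₊, 2 * C * X * ((h : ℝ) / Nat.totient h) :=
        Finset.sum_le_sum_of_subset_of_nonneg hsub fun h _ _ ↦ by positivity
    _ = 2 * C * X * ∑ h ∈ Finset.Icc 1 ⌊2 * η * X⌋₊, (h : ℝ) / Nat.totient h := by rw [Finset.mul_sum]
    _ ≤ 2 * C * X * (3 * ⌊2 * η * X⌋₊) :=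
        mul_le_mul_of_nonneg_left (sum_Icc_div_totient_le_three _) (by positivity)
    _ ≤ 2 * C * X * (3 * (2 * η * X)) := by gcongr
    _ = 12 * C * (η * (X : ℝ) ^ 2) := by ring

/-- Range `m > X`: for fixed `h`, the `m > X` with `h < 2ηm` exceed `Y = max(X, ⌊h/(2η)⌋)`, and
`∑_{m > Y} Λ(m)Λ(m+h)/m³ ≤ (1/Y) ∑_{m > Y} Λ(m)Λ(m+h)/m² ≤ 4C (h/φ(h))/Y²`. [folklore] -/
private theorem region_large_le {C : ℝ} (hC : ∀ h : ℕ, 1 ≤ h → ∀ M : ℕ,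
      ∑ m ∈ Finset.Ioc h M, Λ m * Λ (m + h) ≤ C * ((h : ℝ) / Nat.totient h) * M)
    {x η : ℝ} (hx : 0 ≤ x) (hη : 0 < η) (hη1 : η ≤ 1 / 2) {X : ℕ} (hX1 : 1 ≤ X) (N : ℕ) {h : ℕ} (hh1 : 1 ≤ h) :
    ∑ m ∈ (Finset.Icc 1 N).filter (fun m : ℕ ↦ (h : ℝ) < 2 * η * m),
        (if X < m then 2 * x ^ 3 * ((Λ m * Λ (m + h)) / (m : ℝ) ^ 3) else 0) ≤
      8 * C * x ^ 3 * (((h : ℝ) / Nat.totient h) / ((max X ⌊(h : ℝ) / (2 * η)⌋₊ : ℕ) : ℝ) ^ 2) := by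
  classical
  have hΛΛ0 : ∀ m : ℕ, 0 ≤ Λ m * Λ (m + h) := fun m ↦ mul_nonneg vonMangoldt_nonneg vonMangoldt_nonneg
  set W : ℝ := (h : ℝ) / Nat.totient h with hW
  have hW0 : 0 ≤ W := by positivity
  set Y : ℕ := max X ⌊(h : ℝ) / (2 * η)⌋₊ with hY
  have hY1 : 1 ≤ Y := le_trans hX1 (le_max_left _ _)
  have hY0 : (0 : ℝ) < Y := by exact_mod_cast hY1
  -- the shifted products with Chebyshev-type partial sums
  set f : ℕ → ℝ := fun m ↦ if h < m then Λ m * Λ (m + h) else 0 with hf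
  have hf0 : ∀ m, 0 ≤ f m := by
    intro m; simp only [hf]; split_ifs
    · exact hΛΛ0 m
    · exact le_rfl
  have hfF : ∀ M : ℕ, ∑ m ∈ Finset.Icc 1 M, f m ≤ C * W * M := by
    intro M
    have e : ∑ m ∈ Finset.Icc 1 M, f m = ∑ m ∈ Finset.Ioc h M, Λ m * Λ (m + h) := by
      rw [show Finset.Ioc h M = (Finset.Icc 1 M).filter (fun m ↦ h < m) by
        ext m; simp only [Finset.mem_Ioc, Finset.mem_filter, Finset.mem_Icc]; omega]
      rw [Finset.sum_filter]
    rw [e]; exact hC h hh1 M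
  rw [← Finset.sum_filter]
  have hsub : ((Finset.Icc 1 N).filter (fun m : ℕ ↦ (h : ℝ) < 2 * η * m)).filter (fun m ↦ X < m) ⊆
      Finset.Ioc Y N := by
    intro m hm
    simp only [Finset.mem_filter, Finset.mem_Icc] at hm
    rw [Finset.mem_Ioc]
    refine ⟨?_, hm.1.1.2⟩
    simp only [hY, max_lt_iff]
    refine ⟨hm.2, ?_⟩
    have : (h : ℝ) / (2 * η) < m := by rw [div_lt_iff₀ (by positivity)]; linarith [hm.1.2]
    exact (Nat.floor_lt (by positivity)).2 this
  -- on the range, `h < m`, so the summand is `2x³ f(m)/m³`, and `f(m)/m³ ≤ (1/Y) f(m)/m²`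
  have hterm : ∀ m ∈ Finset.Ioc Y N, f m / (m : ℝ) ^ 3 ≤ (1 / Y) * (f m / (m : ℝ) ^ 2) := by
    intro m hm
    rw [Finset.mem_Ioc] at hm
    have hYm : (Y : ℝ) < m := by exact_mod_cast hm.1
    have hm0 : (0 : ℝ) < m := lt_trans hY0 hYm
    rw [show f m / (m : ℝ) ^ 3 = (1 / m) * (f m / (m : ℝ) ^ 2) by field_simp]
    exact mul_le_mul_of_nonneg_right (one_div_le_one_div_of_le hY0 hYm.le) (by positivity)
  calc ∑ m ∈ ((Finset.Icc 1 N).filter (fun m : ℕ ↦ (h : ℝ) < 2 * η * m)).filter (fun m ↦ X < m),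
        2 * x ^ 3 * (Λ m * Λ (m + h) / (m : ℝ) ^ 3)
      = ∑ m ∈ ((Finset.Icc 1 N).filter (fun m : ℕ ↦ (h : ℝ) < 2 * η * m)).filter (fun m ↦ X < m),
        2 * x ^ 3 * (f m / (m : ℝ) ^ 3) := by
        refine Finset.sum_congr rfl fun m hm ↦ ?_
        simp only [Finset.mem_filter] at hm
        have hm0 : (0 : ℝ) ≤ m := by positivity
        have hlt : (h : ℝ) < m := by nlinarith [hm.1.2, mul_le_mul_of_nonneg_right hη1 hm0]
        have hlt' : h < m := by exact_mod_cast hlt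
        simp only [hf, if_pos hlt']
    _ ≤ ∑ m ∈ Finset.Ioc Y N, 2 * x ^ 3 * (f m / (m : ℝ) ^ 3) :=
        Finset.sum_le_sum_of_subset_of_nonneg hsub fun m _ _ ↦ by have := hf0 m; positivity
    _ ≤ ∑ m ∈ Finset.Ioc Y N, 2 * x ^ 3 * ((1 / Y) * (f m / (m : ℝ) ^ 2)) :=
        Finset.sum_le_sum fun m hm ↦ mul_le_mul_of_nonneg_left (hterm m hm) (by positivity)
    _ = 2 * x ^ 3 * (1 / Y) * ∑ m ∈ Finset.Ioc Y N, f m / (m : ℝ) ^ 2 := by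
        rw [Finset.mul_sum]; exact Finset.sum_congr rfl fun m _ ↦ by ring
    _ ≤ 2 * x ^ 3 * (1 / Y) * (4 * (C * W) / Y) :=
        mul_le_mul_of_nonneg_left (sum_Ioc_div_sq_le_of_chebyshev hY1 hf0 hfF N) (by positivity)
    _ = 8 * C * x ^ 3 * (W / (Y : ℝ) ^ 2) := by field_simp; ring

/-- The `h`-sum in the range `m > X`, small shifts `h ≤ 2ηX`: `∑ (h/φ(h))/X² ≤ 6η/X`. [folklore] -/
private theorem sum_shift_small_le {η : ℝ} (hη : 0 < η) {X : ℕ} (hX1 : 1 ≤ X) (N : ℕ) :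
    ∑ h ∈ (Finset.Icc 1 N).filter (fun h : ℕ ↦ (h : ℝ) ≤ 2 * η * X),
        ((h : ℝ) / Nat.totient h) / (X : ℝ) ^ 2 ≤ 6 * η / X := by
  classical
  have hX0 : (0 : ℝ) < X := by exact_mod_cast hX1
  have hsub : (Finset.Icc 1 N).filter (fun h : ℕ ↦ (h : ℝ) ≤ 2 * η * X) ⊆ Finset.Icc 1 ⌊2 * η * X⌋₊ := by
    intro h hh
    simp only [Finset.mem_filter, Finset.mem_Icc] at hh ⊢
    exact ⟨hh.1.1, Nat.le_floor hh.2⟩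
  have hfl : (⌊2 * η * X⌋₊ : ℝ) ≤ 2 * η * X := Nat.floor_le (by positivity)
  calc ∑ h ∈ (Finset.Icc 1 N).filter (fun h : ℕ ↦ (h : ℝ) ≤ 2 * η * X), ((h : ℝ) / Nat.totient h) / (X : ℝ) ^ 2
      ≤ ∑ h ∈ Finset.Icc 1 ⌊2 * η * X⌋₊, ((h : ℝ) / Nat.totient h) / (X : ℝ) ^ 2 :=
        Finset.sum_le_sum_of_subset_of_nonneg hsub fun h _ _ ↦ by positivity
    _ = (∑ h ∈ Finset.Icc 1 ⌊2 * η * X⌋₊, (h : ℝ) / Nat.totient h) / (X : ℝ) ^ 2 := by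
        rw [Finset.sum_div]
    _ ≤ (3 * ⌊2 * η * X⌋₊) / (X : ℝ) ^ 2 :=
        div_le_div_of_nonneg_right (sum_Icc_div_totient_le_three _) (by positivity)
    _ ≤ (3 * (2 * η * X)) / (X : ℝ) ^ 2 := by gcongr
    _ = 6 * η / X := by field_simp; ring

/-- The `h`-sum in the range `m > X`, large shifts `h > 2ηX`: there `max(X, ⌊h/(2η)⌋) ≥ h/(4η)`, and
`16η² ∑_{h > 2ηX} (h/φ(h))/h² ≤ 400 η/X`. [folklore] -/
private theorem sum_shift_large_le {η : ℝ} (hη : 0 < η) (hη1 : η ≤ 1 / 2) {X : ℕ} (hX1 : 1 ≤ X) (N : ℕ) :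
    ∑ h ∈ (Finset.Icc 1 N).filter (fun h : ℕ ↦ 2 * η * X < (h : ℝ)),
        ((h : ℝ) / Nat.totient h) / ((max X ⌊(h : ℝ) / (2 * η)⌋₊ : ℕ) : ℝ) ^ 2 ≤ 400 * η / X := by
  classical
  have hX0 : (0 : ℝ) < X := by exact_mod_cast hX1
  have hX1r : (1 : ℝ) ≤ X := by exact_mod_cast hX1
  set W : ℕ → ℝ := fun h ↦ (h : ℝ) / Nat.totient h with hW
  have hW0 : ∀ h, 0 ≤ W h := fun h ↦ by positivity
  -- termwise: `W(h)/max² ≤ 16η² W(h)/h²`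
  have hlarge : ∀ h ∈ (Finset.Icc 1 N).filter (fun h : ℕ ↦ 2 * η * X < (h : ℝ)),
      W h / ((max X ⌊(h : ℝ) / (2 * η)⌋₊ : ℕ) : ℝ) ^ 2 ≤ 16 * η ^ 2 * (W h / (h : ℝ) ^ 2) := by
    intro h hh
    simp only [Finset.mem_filter, Finset.mem_Icc] at hh
    have hh0 : (0 : ℝ) < h := by exact_mod_cast hh.1.1
    set Z : ℕ := ⌊(h : ℝ) / (2 * η)⌋₊ with hZ
    have hZgt : (h : ℝ) / (2 * η) < Z + 1 := Nat.lt_floor_add_one _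
    have hZ1 : 1 ≤ Z := by
      have : (1 : ℝ) ≤ (h : ℝ) / (2 * η) := by
        rw [le_div_iff₀ (by positivity)]; nlinarith [hh.2]
      exact Nat.le_floor (by simpa using this)
    have hZ1r : (1 : ℝ) ≤ Z := by exact_mod_cast hZ1
    have hZge : (h : ℝ) / (4 * η) ≤ Z := by
      have : (h : ℝ) / (4 * η) = ((h : ℝ) / (2 * η)) / 2 := by field_simp; ring
      rw [this]; linarith
    have hmaxge : (h : ℝ) / (4 * η) ≤ ((max X Z : ℕ) : ℝ) := hZge.trans (by exact_mod_cast le_max_right _ _)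
    have hpos : 0 < (h : ℝ) / (4 * η) := by positivity
    calc W h / ((max X Z : ℕ) : ℝ) ^ 2 ≤ W h / ((h : ℝ) / (4 * η)) ^ 2 := by
          refine div_le_div_of_nonneg_left (hW0 h) (by positivity) ?_
          exact pow_le_pow_left₀ hpos.le hmaxge 2
      _ = 16 * η ^ 2 * (W h / (h : ℝ) ^ 2) := by field_simp; ring
  refine (Finset.sum_le_sum hlarge).trans ?_
  rw [← Finset.mul_sum]
  by_cases hcase : 1 ≤ ⌊2 * η * X⌋₊
  · -- `2ηX ≥ 1`: the shifts exceed `H = ⌊2ηX⌋ ≥ ηX`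
    set H : ℕ := ⌊2 * η * X⌋₊ with hH
    have hHle : (H : ℝ) ≤ 2 * η * X := Nat.floor_le (by positivity)
    have hHgt : 2 * η * X < H + 1 := Nat.lt_floor_add_one _
    have hH1 : (1 : ℝ) ≤ H := by exact_mod_cast hcase
    have hH0 : (0 : ℝ) < H := by linarith
    have hHge : η * X ≤ H := by
      by_cases h2 : 2 ≤ η * X
      · linarith
      · push Not at h2; nlinarith
    have hsub : (Finset.Icc 1 N).filter (fun h : ℕ ↦ 2 * η * X < (h : ℝ)) ⊆ Finset.Ioc H N := by
      intro h hh
      simp only [Finset.mem_filter, Finset.mem_Icc] at hh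
      rw [Finset.mem_Ioc]
      refine ⟨?_, hh.1.2⟩
      have : (H : ℝ) < h := lt_of_le_of_lt hHle hh.2
      exact_mod_cast this
    have htail := sum_Ioc_div_totient_div_sq_le hcase N
    have hexp3 : Real.exp 1 ≤ 3 := le_of_lt (lt_trans Real.exp_one_lt_d9 (by norm_num))
    calc 16 * η ^ 2 * ∑ h ∈ (Finset.Icc 1 N).filter (fun h : ℕ ↦ 2 * η * X < (h : ℝ)), W h / (h : ℝ) ^ 2
        ≤ 16 * η ^ 2 * ∑ h ∈ Finset.Ioc H N, W h / (h : ℝ) ^ 2 :=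
          mul_le_mul_of_nonneg_left
            (Finset.sum_le_sum_of_subset_of_nonneg hsub fun h _ _ ↦ by positivity) (by positivity)
      _ ≤ 16 * η ^ 2 * (4 * Real.exp 1 / H) := mul_le_mul_of_nonneg_left htail (by positivity)
      _ ≤ 16 * η ^ 2 * (12 / (η * X)) := by
          refine mul_le_mul_of_nonneg_left ?_ (by positivity)
          rw [div_le_div_iff₀ hH0 (by positivity)]
          nlinarith [Real.exp_pos 1]
      _ = 192 * η / X := by field_simp; ring
      _ ≤ 400 * η / X := by
          apply div_le_div_of_nonneg_right _ hX0.le; nlinarith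
  · -- `2ηX < 1`: all shifts `h ≥ 1`; `∑_{h ≥ 1} (h/φ(h))/h² ≤ 1 + 4e`
    push Not at hcase
    have hH0 : ⌊2 * η * X⌋₊ = 0 := by omega
    have hηX : 2 * η * X < 1 := by
      have := (Nat.floor_eq_zero.1 hH0); linarith
    have hsub : (Finset.Icc 1 N).filter (fun h : ℕ ↦ 2 * η * X < (h : ℝ)) ⊆ Finset.Icc 1 N :=
      Finset.filter_subset _ _
    have hIcc : ∑ h ∈ Finset.Icc 1 N, W h / (h : ℝ) ^ 2 ≤ 1 + 4 * Real.exp 1 := by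
      rcases Nat.eq_zero_or_pos N with hN | hN
      · rw [hN]; simp; positivity
      · rw [Finset.Icc_eq_cons_Ioc hN, Finset.sum_cons]
        have h1 : W 1 / ((1 : ℕ) : ℝ) ^ 2 = 1 := by simp [hW]
        rw [h1]
        linarith [sum_Ioc_div_totient_div_sq_le (le_refl 1) N]
    have he : Real.exp 1 < 3 := lt_trans Real.exp_one_lt_d9 (by norm_num)
    calc 16 * η ^ 2 * ∑ h ∈ (Finset.Icc 1 N).filter (fun h : ℕ ↦ 2 * η * X < (h : ℝ)), W h / (h : ℝ) ^ 2
        ≤ 16 * η ^ 2 * ∑ h ∈ Finset.Icc 1 N, W h / (h : ℝ) ^ 2 :=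
          mul_le_mul_of_nonneg_left
            (Finset.sum_le_sum_of_subset_of_nonneg hsub fun h _ _ ↦ by positivity) (by positivity)
      _ ≤ 16 * η ^ 2 * (1 + 4 * Real.exp 1) := mul_le_mul_of_nonneg_left hIcc (by positivity)
      _ ≤ 16 * η ^ 2 * 13 := by
          refine mul_le_mul_of_nonneg_left ?_ (by positivity); linarith
      _ ≤ 400 * η / X := by
          rw [le_div_iff₀ hX0]
          have : η * X < 1 / 2 := by linarith
          nlinarith [hη]

/-! ## The near-diagonal prime-pair sum -/

/-- **The near-diagonal terms** (Goldston–Montgomery 1987, proof of Lemma 7, for Montgomery's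
coefficients): there is an absolute `C` such that for all `x ≥ 1`, `0 < η ≤ 1/2` and all `N`,
`∑_{1 ≤ m ≠ n ≤ N, |log n − log m| < η} a_m a_n ≤ C η x²`, `a_n = Λ(n) a_n(x)`. Printed proof: the primes
`p ∈ (X, 2X]` with a partner at distance `k` number `π₂(x, k) ≪ (k/φ(k)) x/log² x` uniformly, and
`∑_{k ≤ K} k/φ(k) ≪ K`; here with the weights `a_n(x)` of Montgomery's series and the prime powers
included (`Montgomery.exists_sum_Ioc_vonMangoldt_mul_shift_le`). [cite: GoldstonMontgomery1987, §3 Lemma 7 (proof)] -/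
theorem exists_nearDiag_montgomeryCoeff_le :
    ∃ C : ℝ, 0 ≤ C ∧ ∀ x : ℝ, 1 ≤ x → ∀ η : ℝ, 0 < η → η ≤ 1 / 2 → ∀ N : ℕ,
      ∑ m ∈ Finset.Icc 1 N,
        ∑ n ∈ ((Finset.Icc 1 N).erase m).filter (fun n : ℕ ↦ |Real.log n - Real.log m| < η),
          montgomeryCoeff x m * montgomeryCoeff x n ≤ C * (η * x ^ 2) := by
  classical
  obtain ⟨C, hC0, hC⟩ := exists_sum_Ioc_vonMangoldt_mul_shift_le
  refine ⟨14000 * C, by positivity, fun x hx η hη hη1 N ↦ ?_⟩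
  have hx0 : 0 < x := by linarith
  set X : ℕ := ⌊x⌋₊ with hX
  have hX1 : 1 ≤ X := Nat.le_floor (by simpa using hx)
  have hXx : (X : ℝ) ≤ x := Nat.floor_le hx0.le
  have hxX : x < X + 1 := Nat.lt_floor_add_one x
  have hX0 : (0 : ℝ) < X := by exact_mod_cast hX1
  have hxX2 : x ≤ 2 * X := by linarith [show (1 : ℝ) ≤ X from by exact_mod_cast hX1]
  set s := Finset.Icc 1 N with hs
  set a : ℕ → ℝ := montgomeryCoeff x with ha
  have ha0 : ∀ n, 0 ≤ a n := fun n ↦ montgomeryCoeff_nonneg hx0.le n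
  set W : ℕ → ℝ := fun h ↦ (h : ℝ) / Nat.totient h with hW
  have hΛΛ0 : ∀ m h : ℕ, 0 ≤ Λ m * Λ (m + h) := fun m h ↦
    mul_nonneg vonMangoldt_nonneg vonMangoldt_nonneg
  -- Step 1: symmetrise
  have hsym := sum_sum_erase_filter_eq_two_mul s (fun m n ↦ a m * a n) (fun m n ↦ mul_comm _ _)
    (fun m n ↦ |Real.log n - Real.log m| < η) (fun m n h ↦ by rwa [abs_sub_comm])
  -- the summand after the reindexing, and its splitting according to `m ≤ X` / `m > X`
  set F : ℕ → ℕ → ℝ := fun h m ↦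
    2 * Λ m * Λ (m + h) * min ((m : ℝ) ^ 2 / x) (x ^ 3 / (m : ℝ) ^ 2) / m with hF
  have hFle : ∀ h m : ℕ, 1 ≤ m → F h m ≤
      (if m ≤ X then 2 * (Λ m * Λ (m + h)) else 0) +
        (if X < m then 2 * x ^ 3 * ((Λ m * Λ (m + h)) / (m : ℝ) ^ 3) else 0) := by
    intro h m hm1
    by_cases hmX : m ≤ X
    · rw [if_pos hmX, if_neg (not_lt.2 hmX), add_zero]
      have hmx : (m : ℝ) ≤ x := le_trans (by exact_mod_cast hmX) hXx
      have h1 := min_div_le_one hm1 hmx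
      calc F h m = 2 * (Λ m * Λ (m + h)) * (min ((m : ℝ) ^ 2 / x) (x ^ 3 / (m : ℝ) ^ 2) / m) := by
            simp only [hF]; ring
        _ ≤ 2 * (Λ m * Λ (m + h)) * 1 := mul_le_mul_of_nonneg_left h1 (by linarith [hΛΛ0 m h])
        _ = 2 * (Λ m * Λ (m + h)) := mul_one _
    · rw [if_neg hmX, if_pos (not_le.1 hmX), zero_add]
      have h1 := min_div_le_cube (x := x) hm1
      calc F h m = 2 * (Λ m * Λ (m + h)) * (min ((m : ℝ) ^ 2 / x) (x ^ 3 / (m : ℝ) ^ 2) / m) := by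
            simp only [hF]; ring
        _ ≤ 2 * (Λ m * Λ (m + h)) * (x ^ 3 / (m : ℝ) ^ 3) :=
            mul_le_mul_of_nonneg_left h1 (by linarith [hΛΛ0 m h])
        _ = 2 * x ^ 3 * (Λ m * Λ (m + h) / (m : ℝ) ^ 3) := by ring
  -- Step 2: reindex `n = m + h` and weaken the side condition to `h < 2ηm`
  have hstep2 : ∀ m ∈ s, ∑ n ∈ s.filter (fun n ↦ m < n ∧ |Real.log n - Real.log m| < η), a m * a n ≤
      ∑ h ∈ s.filter (fun h : ℕ ↦ (h : ℝ) < 2 * η * m), F h m := by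
    intro m hm
    have hm1 : 1 ≤ m := (Finset.mem_Icc.1 hm).1
    have hm0 : (0 : ℝ) < m := by exact_mod_cast hm1
    calc ∑ n ∈ s.filter (fun n ↦ m < n ∧ |Real.log n - Real.log m| < η), a m * a n
        ≤ ∑ h ∈ s.filter (fun h : ℕ ↦ |Real.log ((m + h : ℕ) : ℝ) - Real.log m| < η), a m * a (m + h) :=
          sum_filter_lt_le_sum_shift N m (fun n ↦ |Real.log n - Real.log m| < η) (fun n ↦ a m * a n)
            (fun n ↦ mul_nonneg (ha0 m) (ha0 n))
      _ ≤ ∑ h ∈ s.filter (fun h : ℕ ↦ (h : ℝ) < 2 * η * m), a m * a (m + h) := by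
          refine Finset.sum_le_sum_of_subset_of_nonneg (fun h hh ↦ ?_)
            (fun h _ _ ↦ mul_nonneg (ha0 m) (ha0 _))
          rw [Finset.mem_filter] at hh ⊢
          exact ⟨hh.1, cast_lt_of_abs_log_lt hm1 hη1 hh.2⟩
      _ ≤ ∑ h ∈ s.filter (fun h : ℕ ↦ (h : ℝ) < 2 * η * m), F h m := by
          refine Finset.sum_le_sum fun h hh ↦ ?_
          rw [Finset.mem_filter] at hh
          have hhm : h ≤ m := by
            have : (h : ℝ) ≤ m := by nlinarith [hh.2, hm0]
            exact_mod_cast this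
          exact montgomeryCoeff_mul_shift_le hx0 hm1 hhm
  -- Step 3: swap the sums
  have hswap : ∑ m ∈ s, ∑ h ∈ s.filter (fun h : ℕ ↦ (h : ℝ) < 2 * η * m), F h m =
      ∑ h ∈ s, ∑ m ∈ s.filter (fun m : ℕ ↦ (h : ℝ) < 2 * η * m), F h m := by
    rw [Finset.sum_comm' (t' := s) (s' := fun h ↦ s.filter (fun m : ℕ ↦ (h : ℝ) < 2 * η * m))]
    intro m h
    simp only [Finset.mem_filter]
    tauto
  -- Step 4: the two ranges
  have hR1 : ∑ h ∈ s, ∑ m ∈ s.filter (fun m : ℕ ↦ (h : ℝ) < 2 * η * m),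
      (if m ≤ X then 2 * (Λ m * Λ (m + h)) else 0) ≤ 12 * C * (η * x ^ 2) := by
    calc ∑ h ∈ s, ∑ m ∈ s.filter (fun m : ℕ ↦ (h : ℝ) < 2 * η * m),
          (if m ≤ X then 2 * (Λ m * Λ (m + h)) else 0)
        ≤ ∑ h ∈ s, (if (h : ℝ) ≤ 2 * η * X then 2 * C * X * W h else 0) :=
          Finset.sum_le_sum fun h hh ↦ region_small_le hC hη1 X N (Finset.mem_Icc.1 hh).1
      _ ≤ 12 * C * (η * (X : ℝ) ^ 2) := sum_region_small_le hC0 hη X N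
      _ ≤ 12 * C * (η * x ^ 2) := by
          have : (X : ℝ) ^ 2 ≤ x ^ 2 := pow_le_pow_left₀ hX0.le hXx 2
          have : η * (X : ℝ) ^ 2 ≤ η * x ^ 2 := mul_le_mul_of_nonneg_left this hη.le
          nlinarith
  have hR2 : ∑ h ∈ s, ∑ m ∈ s.filter (fun m : ℕ ↦ (h : ℝ) < 2 * η * m),
      (if X < m then 2 * x ^ 3 * ((Λ m * Λ (m + h)) / (m : ℝ) ^ 3) else 0) ≤ 6600 * C * (η * x ^ 2) := by
    have hsplit : ∑ h ∈ s, W h / ((max X ⌊(h : ℝ) / (2 * η)⌋₊ : ℕ) : ℝ) ^ 2 ≤ 6 * η / X + 400 * η / X := by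
      rw [← Finset.sum_filter_add_sum_filter_not s (fun h : ℕ ↦ (h : ℝ) ≤ 2 * η * X)]
      refine add_le_add ((Finset.sum_le_sum fun h hh ↦ ?_).trans (sum_shift_small_le hη hX1 N)) ?_
      · refine div_le_div_of_nonneg_left (by positivity) (by positivity) ?_
        gcongr
        exact_mod_cast le_max_left _ _
      · rw [Finset.filter_congr (fun h _ ↦ by exact not_le)]
        exact sum_shift_large_le hη hη1 hX1 N
    calc ∑ h ∈ s, ∑ m ∈ s.filter (fun m : ℕ ↦ (h : ℝ) < 2 * η * m),
          (if X < m then 2 * x ^ 3 * ((Λ m * Λ (m + h)) / (m : ℝ) ^ 3) else 0)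
        ≤ ∑ h ∈ s, 8 * C * x ^ 3 * (W h / ((max X ⌊(h : ℝ) / (2 * η)⌋₊ : ℕ) : ℝ) ^ 2) :=
          Finset.sum_le_sum fun h hh ↦ region_large_le hC hx0.le hη hη1 hX1 N (Finset.mem_Icc.1 hh).1
      _ = 8 * C * x ^ 3 * ∑ h ∈ s, W h / ((max X ⌊(h : ℝ) / (2 * η)⌋₊ : ℕ) : ℝ) ^ 2 := by
          rw [Finset.mul_sum]
      _ ≤ 8 * C * x ^ 3 * (6 * η / X + 400 * η / X) := mul_le_mul_of_nonneg_left hsplit (by positivity)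
      _ = 3248 * C * η * (x ^ 3 / X) := by field_simp; ring
      _ ≤ 3248 * C * η * (2 * x ^ 2) := by
          refine mul_le_mul_of_nonneg_left ?_ (by positivity)
          rw [div_le_iff₀ hX0]
          nlinarith [sq_nonneg x, hxX2, hx0]
      _ ≤ 6600 * C * (η * x ^ 2) := by
          have h0 : 0 ≤ C * (η * x ^ 2) := by positivity
          linarith [h0]
  -- assemble
  have hmain : ∑ m ∈ s, ∑ n ∈ s.filter (fun n ↦ m < n ∧ |Real.log n - Real.log m| < η), a m * a n ≤
      6612 * C * (η * x ^ 2) := by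
    calc ∑ m ∈ s, ∑ n ∈ s.filter (fun n ↦ m < n ∧ |Real.log n - Real.log m| < η), a m * a n
        ≤ ∑ m ∈ s, ∑ h ∈ s.filter (fun h : ℕ ↦ (h : ℝ) < 2 * η * m), F h m :=
          Finset.sum_le_sum hstep2
      _ = ∑ h ∈ s, ∑ m ∈ s.filter (fun m : ℕ ↦ (h : ℝ) < 2 * η * m), F h m := hswap
      _ ≤ ∑ h ∈ s, ∑ m ∈ s.filter (fun m : ℕ ↦ (h : ℝ) < 2 * η * m),
            ((if m ≤ X then 2 * (Λ m * Λ (m + h)) else 0) +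
              (if X < m then 2 * x ^ 3 * ((Λ m * Λ (m + h)) / (m : ℝ) ^ 3) else 0)) := by
          refine Finset.sum_le_sum fun h _ ↦ Finset.sum_le_sum fun m hm ↦ ?_
          simp only [Finset.mem_filter, hs, Finset.mem_Icc] at hm
          exact hFle h m hm.1.1
      _ = ∑ h ∈ s, (∑ m ∈ s.filter (fun m : ℕ ↦ (h : ℝ) < 2 * η * m),
            (if m ≤ X then 2 * (Λ m * Λ (m + h)) else 0)) +
          ∑ h ∈ s, (∑ m ∈ s.filter (fun m : ℕ ↦ (h : ℝ) < 2 * η * m),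
            (if X < m then 2 * x ^ 3 * ((Λ m * Λ (m + h)) / (m : ℝ) ^ 3) else 0)) := by
          rw [← Finset.sum_add_distrib]
          exact Finset.sum_congr rfl fun h _ ↦ Finset.sum_add_distrib
      _ ≤ 12 * C * (η * x ^ 2) + 6600 * C * (η * x ^ 2) := add_le_add hR1 hR2
      _ = 6612 * C * (η * x ^ 2) := by ring
  rw [hsym]
  have : 0 ≤ C * (η * x ^ 2) := by positivity
  linarith [hmain]

/-! ## (P3♯): the mean square with the Goldston–Montgomery remainder -/

/-- `log x + 1 ≤ x` for `x > 0`. [folklore] -/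
private theorem log_add_one_le {x : ℝ} (hx : 0 < x) : Real.log x + 1 ≤ x := by
  linarith [Real.log_le_sub_one_of_pos hx]

/-- **(P3♯) — the mean square of Montgomery's Dirichlet series with the Goldston–Montgomery
remainder** (Goldston–Montgomery 1987, Lemma 7 applied as in the proof of their Lemma 8 / Goldston 2005,
remark after Theorem 1): there is an absolute `C` such that for all `x ≥ 1` and `T ≥ 4`,
`|∫_0^T |∑_n Λ(n) a_n(x) n^{-it}|² dt − T x log x| ≤ C (T x + x² + x √(x T (log x + 1)))`.
Proof: Goldston–Montgomery's Lemma 6 (`SelbergMVT.abs_meanSquare_tsum_sub_le_nearDiag`) with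
`2πΔ = η = √(x T (log x + 1))/(x T)`, the near-diagonal bound `exists_nearDiag_montgomeryCoeff_le`
(`≤ C η x²`), and the diagonal `x log x − O(x) ≤ ∑ (Λ(n) a_n(x))² ≤ x log x + O(x)`
(`exists_le_sum_montgomeryCoeff_sq`, `exists_sum_montgomeryCoeff_sq_le`): the three remainders are
`Δ⁻¹ ∑ a_n² ≪ x √(xT(log x + 1))`, `T · Cηx² ≪ x √(xT(log x + 1))`, `Δ⁻¹ · Cηx² ≪ x²`.
[cite: GoldstonMontgomery1987, §3 Lemma 7] -/
theorem exists_meanSquare_dirichletSum_sharp :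
    ∃ C : ℝ, ∀ x : ℝ, 1 ≤ x → ∀ T : ℝ, 4 ≤ T →
      |(∫ t in (0 : ℝ)..T, ‖montgomeryDirichletSum x t‖ ^ 2) - T * x * Real.log x| ≤
        C * (T * x + x ^ 2 + x * Real.sqrt (x * T * (Real.log x + 1))) := by
  obtain ⟨C₁, hC₁⟩ := exists_sum_montgomeryCoeff_sq_le
  obtain ⟨C₂, hC₂⟩ := exists_le_sum_montgomeryCoeff_sq
  obtain ⟨C₃, hC₃0, hC₃⟩ := exists_nearDiag_montgomeryCoeff_le
  have hC₁0 : 0 ≤ C₁ := by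
    have h := hC₁ 1 le_rfl 0
    simp at h
    exact h
  have hC₂0 : 0 ≤ C₂ := by
    have h := hC₂ 1 le_rfl 1 (by norm_num)
    simp [montgomeryCoeff] at h
    linarith
  refine ⟨2 * π * (1 + C₁) + C₃ + 2 * π * C₃ + C₁ + 2 * C₂, fun x hx T hT ↦ ?_⟩
  have hx0 : 0 < x := by linarith
  have hT0 : 0 < T := by linarith
  have hlx : 0 ≤ Real.log x := Real.log_nonneg hx
  set L : ℝ := Real.log x + 1 with hL
  have hL1 : 1 ≤ L := by rw [hL]; linarith
  have hL0 : 0 < L := by linarith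
  have hLx : L ≤ x := log_add_one_le hx0
  -- the parameter `η = 2πΔ = r/(xT)`, `r = √(xTL)`
  set r : ℝ := Real.sqrt (x * T * L) with hr
  have hr0 : 0 < r := Real.sqrt_pos.2 (by positivity)
  have hr2 : r ^ 2 = x * T * L := Real.sq_sqrt (by positivity)
  set η : ℝ := r / (x * T) with hη
  have hη0 : 0 < η := by positivity
  have hη1 : η ≤ 1 / 2 := by
    rw [hη, div_le_iff₀ (by positivity)]
    -- `r ≤ xT/2` since `r² = xTL ≤ xT · xT/4`
    have h4 : x * T * L ≤ (x * T / 2) ^ 2 := by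
      have : L ≤ x * T / 4 := by nlinarith
      nlinarith
    have := Real.sqrt_le_sqrt h4
    rw [Real.sqrt_sq (by positivity)] at this
    linarith
  set Δ : ℝ := η / (2 * π) with hΔ
  have hΔ0 : 0 < Δ := by positivity
  have h2πΔ : 2 * π * Δ = η := by rw [hΔ]; field_simp
  have h1Δ : 1 / Δ = 2 * π * (x * T) / r := by rw [hΔ, hη]; field_simp
  -- the coefficients as a complex sequence
  set c : ℕ → ℂ := fun n ↦ (montgomeryCoeff x n : ℂ) with hc_def
  have hnorm : ∀ n, ‖c n‖ = montgomeryCoeff x n := fun n ↦ by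
    simp only [hc_def]
    rw [Complex.norm_real, Real.norm_of_nonneg (montgomeryCoeff_nonneg hx0.le n)]
  have hc : Summable fun n ↦ ‖c n‖ := summable_norm_montgomeryCoeff hx0
  have h0 : c 0 = 0 := by simp [hc_def]
  have hsq0 : ∀ n, 0 ≤ ‖c n‖ ^ 2 := fun n ↦ sq_nonneg _
  -- the near-diagonal bound, uniformly in the truncation
  set B : ℝ := C₃ * (η * x ^ 2) with hBdef
  have hB : ∀ N : ℕ, ∑ m ∈ Finset.Icc 1 N,
      ∑ n ∈ ((Finset.Icc 1 N).erase m).filter (fun n : ℕ ↦ |Real.log n - Real.log m| < 2 * π * Δ),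
        ‖c m‖ * ‖c n‖ ≤ B := by
    intro N
    simp_rw [hnorm, h2πΔ]
    exact hC₃ x hx η hη0 hη1 N
  have hMVT := SelbergMVT.abs_meanSquare_tsum_sub_le_nearDiag hc h0 hT0.le hΔ0 hB
  -- the diagonal, from above
  have hdiagU : ∑' n, ‖c n‖ ^ 2 ≤ x * Real.log x + C₁ * x := by
    refine Real.tsum_le_of_sum_range_le hsq0 fun n ↦ ?_
    calc ∑ i ∈ Finset.range n, ‖c i‖ ^ 2 ≤ ∑ i ∈ Finset.range (n + 1), ‖c i‖ ^ 2 :=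
          Finset.sum_le_sum_of_subset_of_nonneg (Finset.range_subset_range.2 (Nat.le_succ n))
            fun i _ _ ↦ hsq0 i
      _ = ∑ i ∈ Finset.Icc 1 n, ‖c i‖ ^ 2 :=
          DirichletMVT.sum_range_succ_eq_sum_Icc (fun i ↦ ‖c i‖ ^ 2) (by simp [h0]) n
      _ = ∑ i ∈ Finset.Icc 1 n, montgomeryCoeff x i ^ 2 := by simp_rw [hnorm]
      _ ≤ x * Real.log x + C₁ * x := hC₁ x hx n
  -- the squares are summable
  have hsqsum : Summable fun n ↦ ‖c n‖ ^ 2 := by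
    refine Summable.of_nonneg_of_le hsq0 (fun n ↦ ?_) (hc.mul_left (4 * x ^ (3 / 2 : ℝ)))
    have hA : ‖c n‖ ≤ 4 * x ^ (3 / 2 : ℝ) := by rw [hnorm]; exact montgomeryCoeff_le_const hx0 n
    calc ‖c n‖ ^ 2 = ‖c n‖ * ‖c n‖ := sq _
      _ ≤ 4 * x ^ (3 / 2 : ℝ) * ‖c n‖ := mul_le_mul_of_nonneg_right hA (norm_nonneg _)
  -- the diagonal, from below (`N = ⌈x²⌉`)
  have hdiagL : x * Real.log x - 2 * C₂ * x ≤ ∑' n, ‖c n‖ ^ 2 := by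
    set N : ℕ := ⌈x ^ 2⌉₊ with hN
    have hxN2 : x ^ 2 ≤ N := Nat.le_ceil _
    have hx2 : x ≤ x ^ 2 := by nlinarith
    have hxN : x ≤ N := hx2.trans hxN2
    have hN0 : (0 : ℝ) < N := by linarith
    have h1 := hC₂ x hx N hxN
    have h2 : ∑ n ∈ Finset.Icc 1 N, montgomeryCoeff x n ^ 2 ≤ ∑' n, ‖c n‖ ^ 2 := by
      calc ∑ n ∈ Finset.Icc 1 N, montgomeryCoeff x n ^ 2 = ∑ n ∈ Finset.Icc 1 N, ‖c n‖ ^ 2 := by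
            simp_rw [hnorm]
        _ ≤ ∑' n, ‖c n‖ ^ 2 := hsqsum.sum_le_tsum _ (fun n _ ↦ hsq0 n)
    have h3 : x ^ 3 * (1 + Real.log N) / (N : ℝ) ^ 2 ≤ x := by
      have hlog : Real.log N ≤ N - 1 := Real.log_le_sub_one_of_pos hN0
      rw [div_le_iff₀ (by positivity)]
      calc x ^ 3 * (1 + Real.log N) ≤ x ^ 3 * N :=
            mul_le_mul_of_nonneg_left (by linarith) (by positivity)
        _ = x * (x ^ 2 * N) := by ring
        _ ≤ x * ((N : ℝ) * N) :=
            mul_le_mul_of_nonneg_left (mul_le_mul_of_nonneg_right hxN2 hN0.le) hx0.le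
        _ = x * (N : ℝ) ^ 2 := by ring
    have h4 : C₂ * (x ^ 3 * (1 + Real.log N) / (N : ℝ) ^ 2) ≤ C₂ * x :=
      mul_le_mul_of_nonneg_left h3 hC₂0
    linarith
  have htsum0 : 0 ≤ ∑' n, ‖c n‖ ^ 2 := tsum_nonneg hsq0
  -- sizes of the three remainders
  have hrem1 : 1 / Δ * ∑' n, ‖c n‖ ^ 2 ≤ 2 * π * (1 + C₁) * (x * r) := by
    rw [h1Δ]
    have h1 : ∑' n, ‖c n‖ ^ 2 ≤ (1 + C₁) * (x * L) := by
      calc ∑' n, ‖c n‖ ^ 2 ≤ x * Real.log x + C₁ * x := hdiagU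
        _ ≤ x * L + C₁ * (x * L) := by
            have : C₁ * x ≤ C₁ * (x * L) := mul_le_mul_of_nonneg_left (by nlinarith) hC₁0
            rw [hL]; nlinarith
        _ = (1 + C₁) * (x * L) := by ring
    calc 2 * π * (x * T) / r * ∑' n, ‖c n‖ ^ 2 ≤ 2 * π * (x * T) / r * ((1 + C₁) * (x * L)) :=
          mul_le_mul_of_nonneg_left h1 (by positivity)
      _ = 2 * π * (1 + C₁) * (x * (x * T * L / r)) := by field_simp
      _ = 2 * π * (1 + C₁) * (x * r) := by rw [← hr2, sq, mul_div_assoc, div_self hr0.ne', mul_one]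
  have hrem2 : (T + 1 / Δ) * B = C₃ * (x * r) + 2 * π * C₃ * x ^ 2 := by
    rw [h1Δ, hBdef, hη]
    field_simp
  have hxr0 : 0 ≤ x * r := by positivity
  -- assemble
  have hdiag : |T * ∑' n, ‖c n‖ ^ 2 - T * x * Real.log x| ≤ T * ((C₁ + 2 * C₂) * x) := by
    have hTC₁ : 0 ≤ T * (C₁ * x) := by positivity
    have hTC₂ : 0 ≤ T * (C₂ * x) := by positivity
    rw [abs_le]
    constructor
    · have := mul_le_mul_of_nonneg_left hdiagL hT0.le
      linarith
    · have := mul_le_mul_of_nonneg_left hdiagU hT0.le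
      linarith
  have hsplit : (∫ t in (0 : ℝ)..T, ‖montgomeryDirichletSum x t‖ ^ 2) - T * x * Real.log x =
      ((∫ t in (0 : ℝ)..T, ‖montgomeryDirichletSum x t‖ ^ 2) - T * ∑' n, ‖c n‖ ^ 2) +
        (T * ∑' n, ‖c n‖ ^ 2 - T * x * Real.log x) := (sub_add_sub_cancel _ _ _).symm
  rw [hsplit]
  have hM : |(∫ t in (0 : ℝ)..T, ‖montgomeryDirichletSum x t‖ ^ 2) - T * ∑' n, ‖c n‖ ^ 2| ≤
      2 * π * (1 + C₁) * (x * r) + (C₃ * (x * r) + 2 * π * C₃ * x ^ 2) := by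
    refine hMVT.trans ?_
    rw [← hrem2]
    linarith [hrem1]
  refine ((abs_add_le _ _).trans (add_le_add hM hdiag)).trans ?_
  have e : (2 * π * (1 + C₁) + C₃ + 2 * π * C₃ + C₁ + 2 * C₂) * (T * x + x ^ 2 + x * r) =
      (2 * π * (1 + C₁) * (x * r) + (C₃ * (x * r) + 2 * π * C₃ * x ^ 2)) + T * ((C₁ + 2 * C₂) * x) +
        ((2 * π * (1 + C₁)) * (T * x + x ^ 2) + C₃ * (T * x + x ^ 2) + 2 * π * C₃ * (T * x + x * r) +
          (C₁ + 2 * C₂) * (x ^ 2 + x * r)) := by ring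
  rw [e]
  have hrest : 0 ≤ (2 * π * (1 + C₁)) * (T * x + x ^ 2) + C₃ * (T * x + x ^ 2) +
      2 * π * C₃ * (T * x + x * r) + (C₁ + 2 * C₂) * (x ^ 2 + x * r) := by positivity
  linarith

end Montgomery

end Literature.NumberTheory.LFunctions

end
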